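import Mathlib
import Summits.RiemannHypothesis.RiemannHypothesis.Theorems.WeilParityOffLineParityDetectionStubBohrTransfer
import Summits.RiemannHypothesis.RiemannHypothesis.Theorems.WeilParityOffLineParityDetectionTorusGramIntegrals
import Summits.RiemannHypothesis.RiemannHypothesis.Theorems.WeilParityOffLineParityDetectionTorusGramMatrix
import Summits.RiemannHypothesis.RiemannHypothesis.Theorems.WeilParityOffLineParityDetectionTorusGramForms
import Summits.RiemannHypothesis.RiemannHypothesis.Theorems.WeilParityOffLineParityDetectionTorusGramCutoff
import Summits.RiemannHypothesis.RiemannHypothesis.Theorems.WeilParityOffLineParityDetectionTorusGramBounds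
import Summits.RiemannHypothesis.RiemannHypothesis.Theorems.WeilParityOffLineParityDetectionTorusGramAssembly
import HarnessLib

/-!
# Crux `OffLineParityDetection`, line `registered`: stub TORUS-SEP (top-heaviness of the
# mirror-pairing form in the separated regime)

Route `WeilParity`, crux
`Summit.RiemannHypothesis.RiemannHypothesis.Theses.WeilParity.OffLineParityDetection`
(item stmt-RiemannHypothesis-15431), line `registered`.  This file proves the registered stub
`stub_torusTopHeavySeparated` BY NAME, with the registered signature (`ζ`-free real analysis).

Setting: `η₀ > 0`, a finite nonempty top layer `T ⊂ {Re ρ = 1/2 + η₀}` with positive weights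
`w`, the Laplace integrals `F_f(ρ) = ∫₀^∞ f e^{-(ρ-1/2)u} du` of smooth compactly supported real
profiles on `[0, ∞)` and the mirror-pairing form `gain(a, f) = Σ_T w Re(e^{2i(Im ρ)a} F_f(ρ)²)`.
Hypothesis (separation): every ordinate and every gap between distinct absolute ordinates is at
least `Δ = 8 J √(η₀ γ⋆)`, `J = card T`, `γ⋆ = max |Im ρ|`.  Conclusion (top-heaviness): at some
phase point `a` there are `D ≥ 0`, `δ > 0` with `-gain(a, f) ≤ D‖f‖²` for every profile and
`gain(a, f₀) ≥ (D + δ)‖f₀‖²` for one profile `f₀ ≠ 0`.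

## Proof (TORUS-analysis §1, §4, §5; all pieces in the imported helper files)

* NORMAL FORM (`…TorusGramForms`, `…TorusGramAssembly`): `gain(a, f) = Σ_g m_g (⟨f,c_g⟩² -
  ⟨f,s_g⟩²)` over the absolute ordinates `g`, `c_g = e^{-ηu}cos(g(u-a))`, `s_g = e^{-ηu}sin(g(u-a))`,
  class weights `m_g = Σ_{|Im ρ| = g} w(ρ) > 0`.  If all ordinates vanish the statement is the
  elementary `torusSep_degenerate`; otherwise `γ⋆ > 0` and we take `a = π/(4γ⋆)`.
* ONE-SIDED TEST-VECTOR LEMMA: `D := λ⋆_S`, the maximum of the weighted sine Gram form on the unit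
  sphere (`torusSep_exists_max_form`), is a danger bound (`torusSep_danger_bound`); the cosine
  maximiser `x` gives the profile `p = Σ x_g √m_g c_g` with `‖p‖² = λ⋆_C` and pairings
  `⟨p, c_g⟩, ⟨p, s_g⟩` = rows of the Gram arrays (`torusSep_profile`).
* SIGN STRUCTURE AND SIZE BOUNDS at `a = π/(4γ⋆)` (`…TorusGramIntegrals`, `…TorusGramBounds`) feed
  the finite-dimensional core `torusSep_matrixInequality` (Perron–Frobenius by hand, Schur test,
  Cauchy–Schwarz; closing condition `4η(J+1) < 3Δ`), giving the STRICT inequality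
  `λ⋆_S ‖p‖² < Σ_g m_g(⟨p,c_g⟩² - ⟨p,s_g⟩²)`.
* CUT-OFF (`…TorusGramCutoff`): the strict inequality passes to a smooth compactly supported
  cut-off `f₀` of `p` by dominated convergence; `δ := (gain(a,f₀) - D‖f₀‖²)/‖f₀‖²`.
-/

set_option linter.dupNamespace false

noncomputable section

namespace Summit.RiemannHypothesis.RiemannHypothesis.Theorems.WeilParityOffLineParityDetection

open MeasureTheory Set Filter Finset
open scoped ComplexConjugate
open Literature.NumberTheory.LFunctions

/-- A damped cosine / sine is bounded by the damping factor. [folklore] -/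
theorem torusSep_abs_damped_le {η : ℝ} (k : ℝ → ℝ) (hk : ∀ v, |k v| ≤ 1) (u v : ℝ) :
    |Real.exp (-(η * u)) * k v| ≤ Real.exp (-(η * u)) := by
  rw [abs_mul, abs_of_pos (Real.exp_pos _)]
  exact mul_le_of_le_one_right (Real.exp_pos _).le (hk v)

/-- Stub **TORUS-SEP** of crux `OffLineParityDetection` (line `registered`), `ζ`-free: in the
separated regime (every ordinate and every gap between distinct absolute ordinates of the top
layer at least `8 · card T · √(η₀ |Im τ|)` for all `τ ∈ T`) the mirror-pairing form
`gain(a, f) = Σ_T w Re(e^{2i(Im ρ)a} F_f(ρ)²)` is top-heavy at the phase point `a = π/(4 max|Im ρ|)`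
(danger bound `D = λ_max` of the weighted sine Gram form, gaining profile a cut-off of the best
cosine combination); see the module docstring for the proof. [folklore] -/
theorem stub_torusTopHeavySeparated :
    ∀ η₀ : ℝ, 0 < η₀ → ∀ T : Finset ℂ, T.Nonempty → (∀ ρ ∈ T, ρ.re = 1 / 2 + η₀) →
      ∀ w : ℂ → ℝ, (∀ ρ ∈ T, 0 < w ρ) →
      (∀ ρ ∈ T, ∀ τ ∈ T, 64 * (T.card : ℝ) ^ 2 * η₀ * |τ.im| ≤ ρ.im ^ 2) →
      (∀ ρ ∈ T, ∀ σ ∈ T, ∀ τ ∈ T, |ρ.im| ≠ |σ.im| →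
        64 * (T.card : ℝ) ^ 2 * η₀ * |τ.im| ≤ (|ρ.im| - |σ.im|) ^ 2) →
      ∃ δ : ℝ, 0 < δ ∧ ∃ a : ℝ, ∃ D : ℝ, 0 ≤ D ∧
        (∀ f : ℝ → ℝ, ContDiff ℝ (⊤ : ℕ∞) f → HasCompactSupport f → tsupport f ⊆ Set.Ici 0 →
          -(∑ ρ ∈ T, w ρ * (Complex.exp (2 * (ρ.im : ℂ) * (a : ℂ) * Complex.I) *
              (∫ u in Set.Ioi (0 : ℝ), (f u : ℂ) * Complex.exp (-((ρ - 1 / 2) * (u : ℂ)))) ^ 2).re)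
            ≤ D * ∫ u in Set.Ioi (0 : ℝ), f u ^ 2) ∧
        (∃ f : ℝ → ℝ, ContDiff ℝ (⊤ : ℕ∞) f ∧ HasCompactSupport f ∧ tsupport f ⊆ Set.Ici 0 ∧
          0 < ∫ u in Set.Ioi (0 : ℝ), f u ^ 2 ∧
          (D + δ) * ∫ u in Set.Ioi (0 : ℝ), f u ^ 2 ≤
            ∑ ρ ∈ T, w ρ * (Complex.exp (2 * (ρ.im : ℂ) * (a : ℂ) * Complex.I) *
              (∫ u in Set.Ioi (0 : ℝ), (f u : ℂ) * Complex.exp (-((ρ - 1 / 2) * (u : ℂ)))) ^ 2).re) := by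
  intro η hη T hTne hTre w hw H1 H2
  classical
  obtain ⟨ρs, hρsT, hρs⟩ := Finset.exists_max_image T (fun ρ : ℂ ↦ |ρ.im|) hTne
  rcases (abs_nonneg ρs.im).eq_or_lt with hγ0 | hγpos
  · -- all ordinates vanish: the elementary degenerate case
    have him : ∀ ρ ∈ T, ρ.im = 0 := fun ρ hρ ↦
      abs_nonpos_iff.1 (le_of_le_of_eq (hρs ρ hρ) hγ0.symm)
    exact torusSep_degenerate η hη T hTne hTre w hw him
  /- ### the separated regime proper: `γ⋆ > 0`, `a = π/(4γ⋆)` -/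
  set γs : ℝ := |ρs.im| with hγs
  have hγne : γs ≠ 0 := hγpos.ne'
  set J : ℝ := (T.card : ℝ) with hJ
  have hJ1 : 1 ≤ J := by
    have h : 0 < T.card := Finset.card_pos.2 hTne
    rw [hJ]
    exact_mod_cast h
  set S : ℝ := 64 * J ^ 2 * η * γs with hS
  have hS0 : 0 < S := by positivity
  set Δ : ℝ := Real.sqrt S with hΔ
  have hΔ0 : 0 < Δ := Real.sqrt_pos.2 hS0
  have hΔsq : Δ ^ 2 = 64 * J ^ 2 * η * γs := Real.sq_sqrt hS0.le
  have hsqrt_le : ∀ d : ℝ, S ≤ d ^ 2 → Δ ≤ |d| := fun d hd ↦ by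
    rw [hΔ, ← Real.sqrt_sq_eq_abs]
    exact Real.sqrt_le_sqrt hd
  have H1' : ∀ ρ ∈ T, S ≤ ρ.im ^ 2 := fun ρ hρ ↦ H1 ρ hρ ρs hρsT
  have hγS : S ≤ γs ^ 2 := by
    have h := H1' ρs hρsT
    rwa [← sq_abs] at h
  have hγ64 : 64 * J ^ 2 * η ≤ γs := by
    have h : 64 * J ^ 2 * η * γs ≤ γs * γs := by rw [← sq]; exact hγS
    exact le_of_mul_le_mul_right h hγpos
  have hΔ64 : 64 * J ^ 2 * η ≤ Δ := by
    rw [hΔ, Real.le_sqrt (by positivity) hS0.le]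
    calc (64 * J ^ 2 * η) ^ 2 = 64 * J ^ 2 * η * (64 * J ^ 2 * η) := by ring
      _ ≤ 64 * J ^ 2 * η * γs := mul_le_mul_of_nonneg_left hγ64 (by positivity)
  have hηΔ : η ≤ Δ := by
    refine le_trans ?_ hΔ64
    have h : (1 : ℝ) ≤ 64 * J ^ 2 := by nlinarith
    nlinarith
  -- the phase point
  set a : ℝ := Real.pi / (4 * γs) with ha
  have ha0 : 0 < a := by positivity
  have hwin : 2 * γs * a ≤ Real.pi / 2 := by
    rw [ha]
    apply le_of_eq
    field_simp
    ring
  have haπ : a / Real.pi = 1 / (4 * γs) := by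
    rw [ha]
    field_simp
  /- ### classes of absolute ordinates -/
  set G : Finset ℝ := T.image (fun ρ : ℂ ↦ |ρ.im|) with hG
  have hGle : ∀ g ∈ G, g ≤ γs := fun g hg ↦ by
    obtain ⟨ρ, hρ, rfl⟩ := Finset.mem_image.1 hg
    exact hρs ρ hρ
  have hGΔ : ∀ g ∈ G, Δ ≤ g := fun g hg ↦ by
    obtain ⟨ρ, hρ, rfl⟩ := Finset.mem_image.1 hg
    exact hsqrt_le ρ.im (H1' ρ hρ)
  have hGsep : ∀ g ∈ G, ∀ h ∈ G, g ≠ h → Δ ≤ |g - h| := fun g hg h hh hne ↦ by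
    obtain ⟨ρ, hρ, rfl⟩ := Finset.mem_image.1 hg
    obtain ⟨σ, hσ, rfl⟩ := Finset.mem_image.1 hh
    exact hsqrt_le _ (H2 ρ hρ σ hσ ρs hρsT hne)
  have hGdich : ∀ g ∈ G, ∀ h ∈ G, g = h ∨ Δ ≤ |g - h| := fun g hg h hh ↦ by
    by_cases e : g = h
    · exact Or.inl e
    · exact Or.inr (hGsep g hg h hh e)
  -- class weights
  set m : ℝ → ℝ := fun g ↦ ∑ ρ ∈ T.filter (fun ρ : ℂ ↦ |ρ.im| = g), w ρ with hm
  have hm0 : ∀ g ∈ G, 0 < m g := fun g hg ↦ by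
    obtain ⟨ρ, hρ, hρg⟩ := Finset.mem_image.1 hg
    exact Finset.sum_pos (fun σ hσ ↦ hw σ (Finset.mem_filter.1 hσ).1)
      ⟨ρ, Finset.mem_filter.2 ⟨hρ, hρg⟩⟩
  -- the closed forms of the half-line integrals
  set Hf : ℝ → ℝ := fun ω ↦
    (2 * η * Real.cos (ω * a) + ω * Real.sin (ω * a)) / (4 * η ^ 2 + ω ^ 2) with hHf
  set Qf : ℝ → ℝ := fun ω ↦
    (ω * Real.cos (ω * a) - 2 * η * Real.sin (ω * a)) / (4 * η ^ 2 + ω ^ 2) with hQf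
  have hH : ∀ ω, Hf ω = (2 * η * Real.cos (ω * a) + ω * Real.sin (ω * a)) / (4 * η ^ 2 + ω ^ 2) :=
    fun ω ↦ rfl
  have hQ : ∀ ω, Qf ω = (ω * Real.cos (ω * a) - 2 * η * Real.sin (ω * a)) / (4 * η ^ 2 + ω ^ 2) :=
    fun ω ↦ rfl
  /- ### the index type of classes, the Gram arrays, the maximisers -/
  have hγsG : γs ∈ G := Finset.mem_image_of_mem (fun ρ : ℂ ↦ |ρ.im|) hρsT
  haveI hne : Nonempty ↥G := ⟨⟨γs, hγsG⟩⟩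
  set mι : ↥G → ℝ := fun i ↦ m i.1 with hmι
  have hmι0 : ∀ i, 0 < mι i := fun i ↦ hm0 i.1 i.2
  set CC : ↥G → ↥G → ℝ := fun i j ↦ (Hf (i.1 - j.1) + Hf (i.1 + j.1)) / 2 with hCC
  set SS : ↥G → ↥G → ℝ := fun i j ↦ (Hf (i.1 - j.1) - Hf (i.1 + j.1)) / 2 with hSS
  set CS : ↥G → ↥G → ℝ := fun i j ↦ (Qf (j.1 - i.1) + Qf (j.1 + i.1)) / 2 with hCS
  have hB := fun i j : ↥G ↦ torusSep_gramBounds η a γs Δ hη ha0 hwin hΔ0 hηΔ Hf Qf hH hQ i.1 j.1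
    (hGΔ _ i.2) (hGle _ i.2) (hGΔ _ j.2) (hGle _ j.2) (hGdich _ i.2 _ j.2)
  obtain ⟨x, hx1, hxmax⟩ :=
    torusSep_exists_max_form (fun i j : ↥G ↦ Real.sqrt (mι i) * Real.sqrt (mι j) * CC i j)
  obtain ⟨y, hy1, hymax⟩ :=
    torusSep_exists_max_form (fun i j : ↥G ↦ Real.sqrt (mι i) * Real.sqrt (mι j) * SS i j)
  set Λc : ℝ := ∑ i, ∑ j, x i * x j * (Real.sqrt (mι i) * Real.sqrt (mι j) * CC i j) with hΛc
  set Λs : ℝ := ∑ i, ∑ j, y i * y j * (Real.sqrt (mι i) * Real.sqrt (mι j) * SS i j) with hΛs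
  /- ### the finite-dimensional core -/
  have hcard : (Fintype.card ↥G : ℝ) ≤ J := by
    rw [Fintype.card_coe, hJ]
    exact_mod_cast Finset.card_image_le
  have hmat := torusSep_matrixInequality mι CC SS CS x y (1 / (4 * η)) (1 / Δ) (a / Real.pi) J
    hmι0 hx1 hxmax hy1 hymax (one_div_pos.2 (by positivity)) (one_div_nonneg.2 hΔ0.le)
    (div_pos ha0 Real.pi_pos) hcard
    (fun i j ↦ (hB i j).2.2.2.2.2.2.2.2) (fun i j ↦ (hB i j).1)
    (fun i j hij ↦ (hB i j).2.1 (hGsep _ i.2 _ j.2 fun e ↦ hij (Subtype.ext e)))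
    (fun i ↦ (hB i i).2.2.1) (fun i ↦ (hB i i).2.2.2.1) (fun i j ↦ (hB i j).2.2.2.2.1)
    (fun i ↦ (hB i i).2.2.2.2.2.1) (fun i ↦ (hB i i).2.2.2.2.2.2.1)
    (fun i j ↦ (hB i j).2.2.2.2.2.2.2.1)
    (by rw [haπ]; exact torusSep_closing hη hγpos hΔ0 hJ1 hΔsq hΔ64)
  -- `Λc > 0` (test vector at the class of `γ⋆`)
  obtain ⟨i₀⟩ := hne
  have hQe : ∑ i, ∑ j, (Pi.single i₀ (1 : ℝ) : ↥G → ℝ) i * (Pi.single i₀ (1 : ℝ) : ↥G → ℝ) j *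
      (Real.sqrt (mι i) * Real.sqrt (mι j) * CC i j) = mι i₀ * CC i₀ i₀ := by
    have h : ∀ i j : ↥G, (Pi.single i₀ (1 : ℝ) : ↥G → ℝ) i * (Pi.single i₀ (1 : ℝ) : ↥G → ℝ) j *
        (Real.sqrt (mι i) * Real.sqrt (mι j) * CC i j) =
        if j = i₀ then (if i = i₀ then Real.sqrt (mι i) * Real.sqrt (mι j) * CC i j else 0)
          else 0 := by
      intro i j
      simp only [Pi.single_apply]
      split_ifs <;> simp only [one_mul, mul_one, zero_mul, mul_zero]
    simp_rw [h, Finset.sum_ite_eq', Finset.mem_univ, if_true]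
    rw [Finset.sum_ite_eq', if_pos (Finset.mem_univ _), Real.mul_self_sqrt (hmι0 i₀).le]
  have he1 : ∑ i, (Pi.single i₀ (1 : ℝ) : ↥G → ℝ) i ^ 2 = 1 := by simp [Pi.single_apply]
  have hΛc0 : 0 < Λc := by
    have h := hxmax (Pi.single i₀ 1)
    rw [hQe, he1, mul_one] at h
    have hCC0 : 1 / (4 * η) ≤ CC i₀ i₀ := (hB i₀ i₀).2.2.2.2.2.2.1
    have h' : 0 < mι i₀ * CC i₀ i₀ := mul_pos (hmι0 i₀) (lt_of_lt_of_le (by positivity) hCC0)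
    linarith
  /- ### the families and the test profile -/
  have hcc_int : ∀ i j : ↥G, IntegrableOn (fun u ↦ Real.exp (-(η * u)) * Real.cos (i.1 * (u - a)) *
      (Real.exp (-(η * u)) * Real.cos (j.1 * (u - a)))) (Ioi 0) := fun i j ↦
    torusSep_integrableOn_prod hη (by fun_prop) (by fun_prop) (fun u ↦ Real.abs_cos_le_one _)
      (fun u ↦ Real.abs_cos_le_one _)
  have hss_int : ∀ i j : ↥G, IntegrableOn (fun u ↦ Real.exp (-(η * u)) * Real.sin (i.1 * (u - a)) *
      (Real.exp (-(η * u)) * Real.sin (j.1 * (u - a)))) (Ioi 0) := fun i j ↦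
    torusSep_integrableOn_prod hη (by fun_prop) (by fun_prop) (fun u ↦ Real.abs_sin_le_one _)
      (fun u ↦ Real.abs_sin_le_one _)
  have hSSint : ∀ i j : ↥G, SS i j = ∫ u in Ioi (0 : ℝ), Real.exp (-(η * u)) *
      Real.sin (i.1 * (u - a)) * (Real.exp (-(η * u)) * Real.sin (j.1 * (u - a))) :=
    fun i j ↦ (torusSep_gram_ss hη a i.1 j.1 hH).symm
  -- `Λs ≥ 0`: it is the energy of `Σ y_i √m_i s_i`
  have hΛs0 : 0 ≤ Λs := by
    have e : Λs = ∫ u in Ioi (0 : ℝ), (∑ i, (y i * Real.sqrt (mι i)) *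
        (Real.exp (-(η * u)) * Real.sin (i.1 * (u - a)))) ^ 2 := by
      rw [torusSep_integral_sum_sq univ _ _ fun i _ j _ ↦ hss_int i j, hΛs]
      refine Finset.sum_congr rfl fun i _ ↦ Finset.sum_congr rfl fun j _ ↦ ?_
      rw [← hSSint]
      ring
    rw [e]
    exact integral_nonneg fun u ↦ sq_nonneg _
  -- the profile `p = Σ x_i √m_i c_i`
  set α : ↥G → ℝ := fun i ↦ x i * Real.sqrt (mι i) with hα
  set p : ℝ → ℝ := fun u ↦ ∑ i, α i * (Real.exp (-(η * u)) * Real.cos (i.1 * (u - a))) with hpdef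
  obtain ⟨hp1, hp2, hp3, hp4, hp5⟩ :=
    torusSep_profile hη a (fun i : ↥G ↦ i.1) α hH hQ (p := p) (fun u ↦ rfl)
  have hp3' : ∫ u in Ioi (0 : ℝ), p u ^ 2 = Λc := by
    rw [hp3, hΛc]
    refine Finset.sum_congr rfl fun i _ ↦ Finset.sum_congr rfl fun j _ ↦ ?_
    rw [hα, hCC]
    ring
  have hp4' : ∀ i : ↥G, ∫ u in Ioi (0 : ℝ), p u * (Real.exp (-(η * u)) * Real.cos (i.1 * (u - a))) =
      ∑ j, x j * Real.sqrt (mι j) * CC j i := fun i ↦ by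
    rw [hp4 i]
  have hp5' : ∀ i : ↥G, ∫ u in Ioi (0 : ℝ), p u * (Real.exp (-(η * u)) * Real.sin (i.1 * (u - a))) =
      ∑ j, x j * Real.sqrt (mι j) * CS j i := fun i ↦ by
    rw [hp5 i]
  have hstrict : Λs * ∫ u in Ioi (0 : ℝ), p u ^ 2 <
      ∑ i : ↥G, mι i * ((∫ u in Ioi (0 : ℝ), p u * (Real.exp (-(η * u)) * Real.cos (i.1 * (u - a)))) ^ 2
        - (∫ u in Ioi (0 : ℝ), p u * (Real.exp (-(η * u)) * Real.sin (i.1 * (u - a)))) ^ 2) := by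
    rw [hp3']
    simp_rw [hp4', hp5', mul_sub, Finset.sum_sub_distrib]
    exact hmat
  /- ### the gaining profile: a cut-off of `p` -/
  obtain ⟨f₀, hf₀1, hf₀2, hf₀3, hf₀pos, hf₀strict⟩ := torusSep_cutoff_select hη hp1 hp2
    (by rw [hp3']; exact hΛc0)
    (fun (i : ↥G) u ↦ Real.exp (-(η * u)) * Real.cos (i.1 * (u - a)))
    (fun (i : ↥G) u ↦ Real.exp (-(η * u)) * Real.sin (i.1 * (u - a)))
    (fun i ↦ by fun_prop) (fun i ↦ by fun_prop)
    (fun i u _ ↦ torusSep_abs_damped_le Real.cos Real.abs_cos_le_one u _)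
    (fun i u _ ↦ torusSep_abs_damped_le Real.sin Real.abs_sin_le_one u _) mι Λs hstrict
  /- ### the form on admissible profiles, the danger bound, the conclusion -/
  have hgainG : ∀ f : ℝ → ℝ, Continuous f → HasCompactSupport f →
      ∑ ρ ∈ T, w ρ * (Complex.exp (2 * (ρ.im : ℂ) * (a : ℂ) * Complex.I) *
        (∫ u in Set.Ioi (0 : ℝ), (f u : ℂ) * Complex.exp (-((ρ - 1 / 2) * (u : ℂ)))) ^ 2).re =
      ∑ i : ↥G, mι i * ((∫ u in Ioi (0 : ℝ), f u * (Real.exp (-(η * u)) * Real.cos (i.1 * (u - a)))) ^ 2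
        - (∫ u in Ioi (0 : ℝ), f u * (Real.exp (-(η * u)) * Real.sin (i.1 * (u - a)))) ^ 2) := by
    intro f hf hfs
    rw [torusSep_gain_classes T hTre w a hf hfs, torusSep_sum_classes_coe]
  have hdanger : ∀ f : ℝ → ℝ, ContDiff ℝ (⊤ : ℕ∞) f → HasCompactSupport f → tsupport f ⊆ Set.Ici 0 →
      -(∑ ρ ∈ T, w ρ * (Complex.exp (2 * (ρ.im : ℂ) * (a : ℂ) * Complex.I) *
        (∫ u in Set.Ioi (0 : ℝ), (f u : ℂ) * Complex.exp (-((ρ - 1 / 2) * (u : ℂ)))) ^ 2).re) ≤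
      Λs * ∫ u in Set.Ioi (0 : ℝ), f u ^ 2 := by
    intro f hf hfs _
    rw [hgainG f hf.continuous hfs]
    have h1 := torusSep_danger_bound mι (fun i ↦ (hmι0 i).le)
      (fun (i : ↥G) u ↦ Real.exp (-(η * u)) * Real.sin (i.1 * (u - a))) (fun i ↦ by fun_prop)
      hss_int SS hSSint Λs hΛs0 hymax hf.continuous hfs
    have h2 : 0 ≤ ∑ i : ↥G, mι i *
        (∫ u in Ioi (0 : ℝ), f u * (Real.exp (-(η * u)) * Real.cos (i.1 * (u - a)))) ^ 2 :=
      Finset.sum_nonneg fun i _ ↦ mul_nonneg (hmι0 i).le (sq_nonneg _)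
    simp only [mul_sub, Finset.sum_sub_distrib] at h1 h2 ⊢
    linarith
  -- the margin
  set Γ : ℝ := ∑ i : ↥G, mι i *
    ((∫ u in Ioi (0 : ℝ), f₀ u * (Real.exp (-(η * u)) * Real.cos (i.1 * (u - a)))) ^ 2 -
      (∫ u in Ioi (0 : ℝ), f₀ u * (Real.exp (-(η * u)) * Real.sin (i.1 * (u - a)))) ^ 2) with hΓ
  set E : ℝ := ∫ u in Ioi (0 : ℝ), f₀ u ^ 2 with hE
  refine ⟨(Γ - Λs * E) / E, div_pos (by linarith) hf₀pos, a, Λs, hΛs0, hdanger, f₀, hf₀1, hf₀2,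
    hf₀3, hf₀pos, ?_⟩
  rw [hgainG f₀ hf₀1.continuous hf₀2, ← hΓ]
  apply le_of_eq
  field_simp
  ring

end Summit.RiemannHypothesis.RiemannHypothesis.Theorems.WeilParityOffLineParityDetection

end
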